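import Summits.FinalStateConjecture.FinalStateConjecture.Theorems.ZeroEnergyKerrOrBombErgoregionBombModTHoveringDalembertian
import Summits.FinalStateConjecture.FinalStateConjecture.Theorems.ZeroEnergyKerrOrBombErgoregionBombModTEvanescentTwist

/-!
# `ErgoregionBombModT` — at a vacuum hovering light point, `□ g(T,T) = 0` iff `∇T` is a null
# bivector, and then `T` is twist-free there (crux stmt-FinalStateConjecture-17838, line
# `killing-light-points`, lead c4)

Route `ZeroEnergyKerrOrBomb` of the Final State Conjecture, crux
`Summit.FinalStateConjecture.FinalStateConjecture.Theses.ZeroEnergyKerrOrBomb.ErgoregionBombModT`,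
line `killing-light-points`, skeleton v4 (`crux ⟺ OffWallBomb ∧ LightPointBomb`, p139708).  The
hovering species of `LightPointBomb` are the points `p` of the d.o.c. with `g(T,T)(p) = 0` and
`∇_T T (p) = 0`.  Two certified facts are sharpened here into an equivalence:

* p143801 (`dalembertian_val_killing_nonneg_of_hoveringLightPoint`): at every hovering light point
  of a Ricci-flat presentation `0 ≤ □ g(T,T)(p)`, because `□ g(T,T) = -2 tr(∇T ∘ ∇T)`
  (O'Neill 1983, Ch. 9, Ex. 9 (c), `Ric(T,T) = 0`) and `tr(∇T ∘ ∇T) = -∑ᵢ g(∇_{eᵢ} T, ∇_{eᵢ} T) ≤ 0`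
  over a screen frame of `T(p)`;
* p144151/p144757: at the EVANESCENT ones (local maxima of `g(T,T)`) `∇T(p) = T♭ ∧ β♭` is a null
  bivector, `□ g(T,T)(p) = 0` and `(T♭ ∧ dT♭)_p = 0`.

**Theorem** (`exists_eq_wedge_iff_dalembertian_eq_zero_of_hovering`).  At a hovering light point
of a presentation with `Ric(T,T)(p) = 0`:
`□ g(T,T)(p) = 0 ↔ ∃ β ⊥ T(p), ∀ v, ∇_v T = g(T,v) β - g(β,v) T` — the inequality of p143801 is an
equality exactly when the Killing `2`-form is the null bivector `T♭ ∧ β♭` (each screen term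
`g(∇_{eᵢ}T, ∇_{eᵢ}T)` vanishes, so `∇_{eᵢ} T ∈ ℝ T`: `exists_eq_wedge_of_skew_of_screen_sq_eq_zero`,
`NullRigidityOfDominatedPair.lean`; conversely `trace_comp_self_eq_zero_of_eq_wedge`), and THEN
`T` is twist-free at `p` (`twistForm_killing_eq_zero_of_leviCivita_eq_wedge`, p144757).  In a null
frame `(T, N, e₁, e₂)` at `p` the `2`-form `∇T` with `∇_T T = 0` is `bᵢ T♭∧eᵢ♭ + d e₁♭∧e₂♭` and
`□ g(T,T)(p) = 4d²`, `T♭ ∧ dT♭ = 2d T♭∧e₁♭∧e₂♭`: **at hovering light points `□ g(T,T)` detects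
exactly the twist of `T`.**  So on a rotating hole the inequality of p143801 is strict at every
hovering light point where the stationary field twists, and the evanescent species (p144151) is the
twist-free extreme.  Registered certificate `hoveringLightPoint_twistForm_eq_zero_of_dalembertian_eq_zero`
of crux stmt-FinalStateConjecture-17838 (a certificate, not an obligation of the skeleton).

References: B. O'Neill, *Semi-Riemannian geometry* (1983), Ch. 9, Ex. 9 (c); S. W. Hawking,
G. F. R. Ellis (1973), §4.2; R. M. Wald, *General Relativity* (1984), §7.1, (7.1.1).
-/

noncomputable section

open Bundle Set Filter Function Module
open scoped Manifold Topology

-- summit = problem name (D-0017)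
set_option linter.dupNamespace false

namespace Summit.FinalStateConjecture.FinalStateConjecture.Theorems.ErgoregionBombModT

open Literature.Geometry.Lorentzian

section Hovering

variable {𝓑 : StationaryAFBlackHole.{0}} [𝓑.metric.HasLeviCivita]

/-- **At a hovering light point, `□ g(T,T)(p) = 0` iff `∇T(p)` is a null bivector `T♭ ∧ β♭`.**
Hypotheses: `Ric(T,T)(p) = 0`, `g(T,T)(p) = 0`, `T(p) ≠ 0`, `∇_T T (p) = 0`.  (`→`): by
`IsKillingField.dalembertian_val_self` and `Ric(T,T)(p) = 0`, `tr(∇T ∘ ∇T)(p) = 0`; by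
`trace_comp_self_nonpos_of_skew_of_apply_null` (p143801) this trace is `-∑ᵢ g(∇_{eᵢ}T, ∇_{eᵢ}T)`
over an orthonormal screen frame of `T(p)`, a sum of nonnegative terms (`nonneg_of_orthogonal_null`),
so each vanishes and `exists_eq_wedge_of_skew_of_screen_sq_eq_zero` applies.  (`←`):
`trace_comp_self_eq_zero_of_eq_wedge`.  O'Neill 1983, Ch. 9, Ex. 9 (c); Hawking–Ellis 1973, §4.2.
[cite: ONeill1983, Ch. 9, Ex. 9 (c)] -/
theorem exists_eq_wedge_iff_dalembertian_eq_zero_of_hovering {p : 𝓑.carrier}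
    (hRic : 𝓑.metric.ricci p (𝓑.killing p) (𝓑.killing p) = 0)
    (hnull : 𝓑.metric.val p (𝓑.killing p) (𝓑.killing p) = 0) (hT0 : 𝓑.killing p ≠ 0)
    (hacc : 𝓑.metric.leviCivita 𝓑.killing p (𝓑.killing p) = 0) :
    𝓑.metric.dalembertian (fun y ↦ 𝓑.metric.val y (𝓑.killing y) (𝓑.killing y)) p = 0 ↔
      ∃ β : TangentSpace (𝓡 4) p, 𝓑.metric.val p β (𝓑.killing p) = 0 ∧
        ∀ v, 𝓑.metric.leviCivita 𝓑.killing p v =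
          𝓑.metric.val p (𝓑.killing p) v • β - 𝓑.metric.val p β v • 𝓑.killing p := by
  set g := 𝓑.metric.toPseudoRiemannianMetric with hg
  have hK : g.IsKillingField 𝓑.killing := 𝓑.isStationaryKilling.isKillingField
  set A : TangentSpace (𝓡 4) p →L[ℝ] TangentSpace (𝓡 4) p := g.leviCivita 𝓑.killing p with hAdef
  have hA : ∀ v w, g.val p ((A : TangentSpace (𝓡 4) p →ₗ[ℝ] TangentSpace (𝓡 4) p) v) w +
      g.val p v ((A : TangentSpace (𝓡 4) p →ₗ[ℝ] TangentSpace (𝓡 4) p) w) = 0 :=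
    fun v w ↦ hK.2 p v w
  have hAℓ : (A : TangentSpace (𝓡 4) p →ₗ[ℝ] TangentSpace (𝓡 4) p) (𝓑.killing p) = 0 := hacc
  -- `□ g(T,T)(p) = -2 tr(A ∘ A)`
  have hRic' : g.ricci p (𝓑.killing p) (𝓑.killing p) = 0 := hRic
  have hdal := hK.dalembertian_val_self ENat.LEInfty.out p
  rw [hRic', mul_zero, sub_zero] at hdal
  -- an orthonormal screen frame of the null vector `T(p)`
  obtain ⟨Tm, hTm⟩ := 𝓑.metric.exists_timelike p
  obtain ⟨e, hon, heℓ, -⟩ := exists_orthonormal_screen (V := E4) (g.val p)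
    (fun v w ↦ g.symm p v w) (fun t w ↦ 𝓑.metric.pos_of_orthogonal p t w) hTm hnull hT0
  have h4 : finrank ℝ E4 = 4 := finrank_euclideanSpace_fin
  have hcard : Fintype.card (Fin (finrank ℝ E4 - 2)) + 2 = finrank ℝ E4 := by
    rw [Fintype.card_fin, h4]
  obtain ⟨htr, -⟩ := trace_comp_self_nonpos_of_skew_of_apply_null (V := E4) (g.val p)
    (fun v w ↦ g.symm p v w) (fun t w ↦ 𝓑.metric.pos_of_orthogonal p t w) hTm hon hnull hT0 heℓ
    hcard (A : TangentSpace (𝓡 4) p →ₗ[ℝ] TangentSpace (𝓡 4) p) hA hAℓ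
  have htr' : LinearMap.trace ℝ (TangentSpace (𝓡 4) p)
      ((A : TangentSpace (𝓡 4) p →ₗ[ℝ] TangentSpace (𝓡 4) p) ∘ₗ
        (A : TangentSpace (𝓡 4) p →ₗ[ℝ] TangentSpace (𝓡 4) p)) =
      -∑ i, g.val p (A (e i)) (A (e i)) := htr
  rw [htr'] at hdal
  -- `A v ⊥ T(p)`, so each screen term is nonnegative
  have hAskewℓ : ∀ v, g.val p (A v) (𝓑.killing p) = 0 := fun v ↦ by
    have := hA v (𝓑.killing p)
    change g.val p (A v) (𝓑.killing p) + g.val p v (A (𝓑.killing p)) = 0 at this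
    have h0 : A (𝓑.killing p) = 0 := hacc
    rw [h0, map_zero] at this
    linarith
  have hnn : ∀ i, 0 ≤ g.val p (A (e i)) (A (e i)) := fun i ↦
    nonneg_of_orthogonal_null (V := E4) (g.val p) (fun t w ↦ 𝓑.metric.pos_of_orthogonal p t w)
      hnull hT0 (hAskewℓ (e i))
  constructor
  · intro h0
    rw [h0] at hdal
    -- `∑ᵢ g(A eᵢ, A eᵢ) = 0` with nonnegative terms
    have hsum : ∑ i, g.val p (A (e i)) (A (e i)) = 0 := by linarith
    have hAe : ∀ i, g.val p ((A : TangentSpace (𝓡 4) p →ₗ[ℝ] TangentSpace (𝓡 4) p) (e i))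
        ((A : TangentSpace (𝓡 4) p →ₗ[ℝ] TangentSpace (𝓡 4) p) (e i)) = 0 := by
      have h := (Finset.sum_eq_zero_iff_of_nonneg fun i _ ↦ hnn i).1 hsum
      exact fun i ↦ h i (Finset.mem_univ i)
    obtain ⟨β, hβℓ, hAβ⟩ := exists_eq_wedge_of_skew_of_screen_sq_eq_zero (V := E4) (g.val p)
      (fun v w ↦ g.symm p v w) (fun t w ↦ 𝓑.metric.pos_of_orthogonal p t w) hTm hon hnull hT0
      heℓ hcard (A : TangentSpace (𝓡 4) p →ₗ[ℝ] TangentSpace (𝓡 4) p) hA hAℓ hAe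
    exact ⟨β, hβℓ, fun v ↦ hAβ v⟩
  · rintro ⟨β, hβℓ, hAβ⟩
    have htr0 := (trace_comp_self_eq_zero_of_eq_wedge (V := E4) (g.val p) hnull hβℓ
      (fun v w ↦ g.symm p v w)
      (A : TangentSpace (𝓡 4) p →ₗ[ℝ] TangentSpace (𝓡 4) p) (fun v ↦ hAβ v)).2
    have htr0' : LinearMap.trace ℝ (TangentSpace (𝓡 4) p)
        ((A : TangentSpace (𝓡 4) p →ₗ[ℝ] TangentSpace (𝓡 4) p) ∘ₗ
          (A : TangentSpace (𝓡 4) p →ₗ[ℝ] TangentSpace (𝓡 4) p)) = 0 := htr0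
    rw [htr'] at htr0'
    rw [hdal, htr0', mul_zero]

/-- **At a hovering light point with `□ g(T,T)(p) = 0` the stationary field is twist-free**:
`(T♭ ∧ dT♭)_p = 0` (the previous equivalence and
`twistForm_killing_eq_zero_of_leviCivita_eq_wedge`, p144757).  Wald 1984, §7.1, (7.1.1).
[cite: Wald1984, §7.1 (7.1.1) and App. B.3] -/
theorem twistForm_killing_eq_zero_of_hovering_of_dalembertian_eq_zero {p : 𝓑.carrier}
    (hRic : 𝓑.metric.ricci p (𝓑.killing p) (𝓑.killing p) = 0)
    (hnull : 𝓑.metric.val p (𝓑.killing p) (𝓑.killing p) = 0) (hT0 : 𝓑.killing p ≠ 0)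
    (hacc : 𝓑.metric.leviCivita 𝓑.killing p (𝓑.killing p) = 0)
    (hdal : 𝓑.metric.dalembertian (fun y ↦ 𝓑.metric.val y (𝓑.killing y) (𝓑.killing y)) p = 0)
    (u v w : TangentSpace (𝓡 4) p) : 𝓑.metric.twistForm 𝓑.killing p u v w = 0 := by
  obtain ⟨β, -, hAβ⟩ :=
    (exists_eq_wedge_iff_dalembertian_eq_zero_of_hovering hRic hnull hT0 hacc).1 hdal
  exact twistForm_killing_eq_zero_of_leviCivita_eq_wedge hAβ u v w

end Hovering

/-- **A vacuum hovering light point with `□ g(T,T)(p) = 0` is a twist-free point of `T`**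
(registered certificate `hoveringLightPoint_twistForm_eq_zero_of_dalembertian_eq_zero` of crux
stmt-FinalStateConjecture-17838 — a certificate, not an obligation of the skeleton): for a
Ricci-flat presentation, at a point `p` with `g(T,T)(p) = 0`, `T(p) ≠ 0`, `∇_T T (p) = 0` and
`□ g(T,T)(p) = 0`, `(T♭ ∧ dT♭)_p = 0`.  With p143801 (`□ ≥ 0`): at hovering light points the sign of
`□ g(T,T)` detects the twist of `T`. [cite: Wald1984, §7.1 (7.1.1) and App. B.3] -/
theorem hoveringLightPoint_twistForm_eq_zero_of_dalembertian_eq_zero :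
    ∀ (𝓑 : Literature.Geometry.Lorentzian.StationaryAFBlackHole.{0}) [𝓑.metric.HasLeviCivita], 𝓑.metric.toPseudoRiemannianMetric.IsRicciFlat → ∀ p : 𝓑.carrier, 𝓑.metric.val p (𝓑.killing p) (𝓑.killing p) = 0 → 𝓑.killing p ≠ 0 → 𝓑.metric.leviCivita 𝓑.killing p (𝓑.killing p) = 0 → 𝓑.metric.dalembertian (fun y ↦ 𝓑.metric.val y (𝓑.killing y) (𝓑.killing y)) p = 0 → ∀ u v w : TangentSpace (𝓡 4) p, 𝓑.metric.twistForm 𝓑.killing p u v w = 0 := by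
  intro 𝓑 _ hRic p hnull hT0 hacc hdal u v w
  have hR : 𝓑.metric.ricci p (𝓑.killing p) (𝓑.killing p) = 0 := by
    rw [show 𝓑.metric.ricci p = 0 from hRic p]; rfl
  exact twistForm_killing_eq_zero_of_hovering_of_dalembertian_eq_zero hR hnull hT0 hacc hdal u v w

end Summit.FinalStateConjecture.FinalStateConjecture.Theorems.ErgoregionBombModT

end
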